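import Summits.BirchSwinnertonDyer.BirchSwinnertonDyer.Theorems.ByReductionTypeAtTwoFineSelmerConjAAtTwoAdditivePotGoodClassNumberOneCriterion
import Summits.BirchSwinnertonDyer.BirchSwinnertonDyer.Theorems.ByReductionTypeAtTwoFineSelmerConjAAtTwoAdditivePotGoodTwoLayerStampsEvenIndexC
import HarnessLib

/-!
# Route `ByReductionTypeAtTwo` (rung K4), crux C1″ `FineSelmerConjAAtTwoAdditivePotGood` (item stmt-BirchSwinnertonDyer-22615):
# CLASS NUMBER ONE FOR THE TOTALLY REAL CUBIC FIELD OF DISCRIMINANT `9980` (`X³ − X² − 36X − 70`) BY A NORM CERTIFICATE (KERNEL) —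
# the `2`-torsion field of the census row `279440c1` (`2 = 𝔭²𝔮`), whose two-layer stamp thereby drops to ONE bit
# (a `--supports 22615` file; seat `bsd-2adic-k4-w1` GEN 6; first consumer of `…ClassNumberOneCriterion`)

HONEST FRAMING (cell `bsd-2adic`, D-0036/D-0054): §1 UNCONDITIONAL kernel arithmetic; §2 conditional on `hLim2` BY NAME and ONE displayed bit
(`e₁ = 0`, i.e. `2 ∤ h(ℚ(θ, √2))`, census `cyc6 = []`); closes nothing at the `∀`-level; nothing booked; BSD is not proved by any of this.

THE CERTIFICATE. `g = X³ − X² − 36X − 70`, `disc g = 9980 = d_K` (GEN 5 `…TwoLayerStampsEvenIndexC`: odd-index model; in fact index `1`),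
`M_K ≤ (4/3.14)(6/27)√9980 < 29`. Roots of `g` modulo the primes `ℓ < 29`: `2: {0, 1}`, `3: {2}`, `5: {0, 3}` (`5 ∣ d_K`), `7: {0}`, `23: {2}`,
none modulo `11, 13, 17, 19`. Norm-`ℓ` generators `x + yθ + zθ²` with `ℓ ∣ x + ya + za²` (found by lattice reduction of `(ℓ, θ − a)`; the
unit group has rank `2`, so plain coordinate search fails already for `(3, 2)`): see the docstring of `classNumber_eq_one_of_root_d9980`.
GEN 5 listed this field under «Minkowski for |d| ≥ 6756 two-bit rows (B ≥ 24)» as not attempted; the generic criterion makes it a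
`40`-line proof.

References: [Marcus1977] Ch. 5 Thm. 35–37; [Cohen1993] §6.3, App. B (totally real cubic fields); [Fukuda1994] Thm. 1 (1);
[Lim2017FineSelmer] Thm. 3.5, Lemma 3.2.
-/

set_option autoImplicit false
-- sibling precedent (`…ClassNumberOneCriterion.lean`): the directory name repeats the summit name
set_option linter.dupNamespace false

noncomputable section

open scoped Classical IntermediateField NumberField Real nonZeroDivisors

namespace Summit.BirchSwinnertonDyer.BirchSwinnertonDyer.Theorems.AddKatoTwo

open WeierstrassCurve Field Polynomial IsDedekindDomain NumberField Matrix Literature.NumberTheory.EllipticCurves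
  Literature.NumberTheory.GaloisRepresentations
  Literature.NumberTheory.IwasawaTheory
  Summit.BirchSwinnertonDyer.BirchSwinnertonDyer.Theorems.AlignedTransportAtTwoTorsionPointField
  Summit.BirchSwinnertonDyer.BirchSwinnertonDyer.Theses.ByReductionTypeAtTwo

/-! ## §1 The certificate: `h = 1` for the field of `X³ − X² − 36X − 70` -/

section Certificate

variable (K : Type) [Field K] [NumberField K]

/-- **`h = 1` for every cubic number field containing a root `θ` of `X³ + (-1)X² + (-36)X + (-70)`** (`|disc| = 9980`, `M_K < 29`), by the
norm certificate (`ℓ`, `a` ↦ `(x, y, z)` with `ℓ ∣ x + ya + za²`, `|N(x + yθ + zθ²)| = ℓ`): `(2,0)`: `(-8,-3,0)`; `(2,1)`: `(3,1,0)`; `(3,2)`: `(97,23,-5)`; `(5,0)`: `(-5,-5,-1)`; `(5,3)`: `(79,11,-3)`; `(7,0)`: `(-7,-2,0)`; `(23,2)`: `(-17,-5,1)`. KERNEL. The `2`-torsion cubic field of the census row `279440c1` (totally real, `d = 9980 = 2²·5·499`, monogenic: `disc = d_K`).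
[cite: Marcus1977, Ch. 5 Thm. 37 and Cor. 2] [cite: Cohen1993, §6.3] -/
theorem classNumber_eq_one_of_root_d9980 (h3 : Module.finrank ℚ K = 3) (b : 𝓞 K)
    (hb : b ^ 3 + (-1 : ℤ) * b ^ 2 + (-36 : ℤ) * b + (-70 : ℤ) = 0) : NumberField.classNumber K = 1 := by
  have hirr := irreducible_cubic_d9980p
  have hd : |NumberField.discr K| ≤ (9980 : ℕ) :=
    (abs_discr_le_abs_cubic_discr K h3 b hirr hb).trans (by simp only [Cubic.discr]; norm_num)
  refine classNumber_eq_one_of_normCertificate K h3 b hirr hb (B := 29)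
    (minkowskiBound_lt_of_sqrt_le K h3 hd (s := 99.90)
      ((Real.sqrt_le_sqrt (by norm_num : ((9980 : ℕ) : ℝ) ≤ (99.90 : ℝ) ^ 2)).trans (Real.sqrt_sq (by norm_num)).le)
      (by norm_num)) ?_
  intro ℓ hℓB hℓ a ha hdvd
  interval_cases ℓ <;> norm_num at hℓ
  · -- `ℓ = 2`: roots [0, 1]
    interval_cases a <;> norm_num at hdvd
    · exact ⟨-8, -3, 0, by norm_num, by norm_num⟩
    · exact ⟨3, 1, 0, by norm_num, by norm_num⟩
  · -- `ℓ = 3`: roots [2]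
    interval_cases a <;> norm_num at hdvd
    · exact ⟨97, 23, -5, by norm_num, by norm_num⟩
  · -- `ℓ = 5`: roots [0, 3]
    interval_cases a <;> norm_num at hdvd
    · exact ⟨-5, -5, -1, by norm_num, by norm_num⟩
    · exact ⟨79, 11, -3, by norm_num, by norm_num⟩
  · -- `ℓ = 7`: roots [0]
    interval_cases a <;> norm_num at hdvd
    · exact ⟨-7, -2, 0, by norm_num, by norm_num⟩
  · -- `ℓ = 11`: roots none
    interval_cases a <;> norm_num at hdvd
  · -- `ℓ = 13`: roots none
    interval_cases a <;> norm_num at hdvd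
  · -- `ℓ = 17`: roots none
    interval_cases a <;> norm_num at hdvd
  · -- `ℓ = 19`: roots none
    interval_cases a <;> norm_num at hdvd
  · -- `ℓ = 23`: roots [2]
    interval_cases a <;> norm_num at hdvd
    · exact ⟨-17, -5, 1, by norm_num, by norm_num⟩

end Certificate

/-! ## §2 The census row `279440c1`: two bits ⟶ one bit -/

/-- **(A)₂ for `279440c1` from ONE parity bit** (was: two bits, `conjA_two_279440c1_of_twoBits`): the parity of `h(ℚ(θ))` is now KERNEL
(`h = 1`, §1), so only «`e_1 = 0` along the cyclotomic `ℤ₂`-extensions of `ℚ(θ)`» = `2 ∤ h(ℚ(θ, √2))` (census `cyc6 = []`) stays displayed;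
granted `hLim2` BY NAME. `θ` is any root of `X³ − X² − 36X − 70`. [cite: Lim2017FineSelmer, §3 Thm. 3.5 and Lemma 3.2]
[cite: Fukuda1994, Thm. 1 (1), p. 264] [cite: Cohen1993, App. B (d = 9980)] -/
theorem conjA_two_279440c1_of_layerOneBit
    (hLim2 : Lim2017.thm35_at_two_fineSelmerDual_moduleFinite_of_classicalMuVanishes_of_le_divisionField_four)
    {θ : AlgebraicClosure ℚ} (hθ : aeval θ (Cubic.toPoly ⟨1, ((-1 : ℤ) : ℚ), ((-36 : ℤ) : ℚ), ((-70 : ℤ) : ℚ)⟩) = 0)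
    (h1 : haveI : FiniteDimensional ℚ (IntermediateField.adjoin ℚ {θ}) :=
        IntermediateField.adjoin.finiteDimensional ((AlgebraicClosure.isAlgebraic ℚ).isAlgebraic θ).isIntegral
      haveI : NumberField (IntermediateField.adjoin ℚ {θ}) := NumberField.mk
      ∀ κL : ZpExtension (IntermediateField.adjoin ℚ {θ}) 2, κL.IsCyclotomic → classNumberPExp κL 1 = 0)
    (κ : ZpExtension ℚ 2) (hκ : κ.IsCyclotomic) :
    haveI := isElliptic_279440c1'
    ∃ (γ : absoluteGaloisGroup ℚ) (D : (⟨0, ((1 : ℤ) : ℚ), 0, ((-114041197436 : ℤ) : ℚ), ((-14823196533966296 : ℤ) : ℚ)⟩ : WeierstrassCurve ℚ).FineSelmerDualData κ γ),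
      Module.Finite ℤ_[2] (RestrictScalars ℤ_[2] (IwasawaAlgebra 2) D.X) :=
  conjA_two_279440c1_of_twoBits hLim2 hθ
    (not_two_dvd_card_classGroup_adjoin_of_forall_cubicField irreducible_cubic_d9980p (classNumber_eq_one_of_root_d9980) hθ) h1 κ hκ

end Summit.BirchSwinnertonDyer.BirchSwinnertonDyer.Theorems.AddKatoTwo

end
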